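import Literature.Analysis.FluidPDE.PineauVicolOneSlicePressure
import Literature.Analysis.FluidPDE.PineauVicolOneSliceGradient
import Literature.Analysis.FluidPDE.PineauVicolOneSliceSmallDissipation
import Literature.Analysis.FluidPDE.PineauVicolOneSliceHigherGradient
import HarnessLib

/-!
# Pineau–Vicol 2026, Theorem 1.9 — the printed proof: the reduction to Lemma 9.4 and §9.3

Analysis/FluidPDE proof file, eighth sibling of `PineauVicolOneSlice.lean` (the named fact
`Literature.Analysis.FluidPDE.pineauVicol2026_oneSlice_regularity`, B. Pineau, V. Vicol,
arXiv:2607.09619 (2026), Thm. 1.9). This file assembles everything the tree has proved about the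
printed proof (§9, p. 29–35) into one implication,

  `pineauVicol2026_oneSlice_regularity_of_core' (hA) (hB) : pineauVicol2026_oneSlice_regularity`,

whose two hypotheses are the remaining analytic inputs, spelled out in the physical variables
(see the theorem's docstring; in this variant `hA` is also fed the order-`2` Type I bound of
Corollary 9.3, `exists_forall_iteratedFDeriv_le_of_typeI_of_bounds 2`, which the tree's `L²`
proof of Lemma 9.4 (`PineauVicolSmallVorticityPropagation`) uses): `hA` = Lemma 9.4 (propagation of small vorticity, with the
printed dependence of its constants: `ϑ` universal, `R_* = R_*(θ, C_u, K)`, `s_* = s_*(R, …)`)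
and `hB` = §9.3 (the one-slice smallness `‖Ω(·, s̄)‖_{L²(B_{2R})} ≤ θ/2` from (1.17), with
`δ₀ = δ₀(C_u, θ, R)` and `s₀ = s₀(C_u, C_p, …)`). Proved ingredients used: Prop. 9.5 with all its
integrability inputs (`pineauVicol_regular_of_zoom_small`: interior suitability, `u ∈ L^∞L²`,
`∇u ∈ L²`, `p ∈ L^{3/2}`, the CKN criterion at the vertex, scaling), Lemma 9.2 for `k = 1` with
`K = K(C_u)` (`exists_forall_fderiv_le_of_typeI_of_bounds`), the bounds `B_u(C_u)`,
`B_p(C_u, C_p)` (`lintegral_typeI_cube_le`, `exists_lintegral_pressure_rpow_threeHalves_le`),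
and (9.15)–(9.16) (`exists_cknE_le_of_core_small`). The quantifier structure of Theorem 1.9
(`δ₀` depends on `C_u` only, `s₀` on `C_u, C_p`) is respected: `θ = min(ϑ, √(ε/20))`,
`R = max(R₀, 4JK²/θ²)` and `δ₀` are fixed before `C_p`; `c₁`, `T₀`, `s₁`,
`s₀ = max(s₁, 1 − log T₀)` after.

## References

* B. Pineau, V. Vicol, arXiv:2607.09619 (2026), §9: Lemma 9.4, Prop. 9.5, §9.3 (p. 31–35).
  [PineauVicol2026]
-/

noncomputable section

open MeasureTheory Set Function Filter Metric TopologicalSpace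
open _root_.Topology
open scoped ENNReal NNReal InnerProductSpace RealInnerProductSpace

namespace Literature.Analysis.FluidPDE

section Reduction

-- nested operator types
set_option maxSynthPendingDepth 3

/-- **Theorem 1.9 reduced to its two analytic inputs.** The printed proof of Theorem 1.9
(§9.2–§9.3) rests on two analytic statements about the classical solutions of Theorem 1.9,
here spelled out in the physical variables as hypotheses:

* `hA` — **Lemma 9.4 (propagation of small vorticity)**, combined with the Type I gradient
  bound of Lemma 9.2: a universal `ϑ > 0`; for `θ ≤ ϑ` and the constants `C_u`, `K` a radius
  `R₀ ≥ 2`; for `R ≥ R₀` and the scale `c₁` of the gradient bound a time `T₀ > 0`; such that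
  small vorticity on one slice, `∫_{B(2R√(−t̄))} |ω(t̄)|² ≤ θ²/(4√(−t̄))` (i.e.
  `‖Ω(·, s̄)‖_{L²(B_{2R})} ≤ θ/2`), `−T₀ < t̄ < 0`, propagates to a small core dissipation
  `∫_{B(½R√(−t))} |∇u(t)|² ≤ 4θ²/√(−t)` for `t̄ ≤ t < 0` (i.e. `‖∇U(·,s)‖_{L²(B_{R/2})} ≤ 2θ`,
  (9.6) and the last clause of Lemma 9.4);
* `hB` — **§9.3 (the one-slice smallness of the vorticity from (1.17))**: for `C_u`, `θ`, `R`
  there is `δ₀ = δ₀(C_u, θ, R) ∈ (0,1]`, and for every `C_p` an `s₁ ≥ 1`, such that (1.15),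
  (1.16) and the slice condition (1.17) at `t̄ ∈ (−e^{−s₁}, 0)` give
  `∫_{B(2R√(−t̄))} |ω(t̄)|² ≤ θ²/(4√(−t̄))` (the Bernoulli identity (9.20) against the
  principal Dirichlet eigenfunction of `L̄*`, Lemmas 5.3–5.4, Harnack; (9.21)–(9.25)).

Everything else is proved in the tree and assembled here exactly as on p. 33–35: the universal
`ε` of the CKN criterion (`pineauVicol_regular_of_zoom_small`, which contains Prop. 9.5's
suitability, the classes `u ∈ L^∞L²`, `∇u ∈ L²`, `p ∈ L^{3/2}`), `θ = min(ϑ, √(ε/20))`,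
`K = K(C_u)`, `K₂ = K₂(C_u)` (Lemma 9.2 / Cor. 9.3, `exists_forall_fderiv_le_of_typeI_of_bounds`,
`exists_forall_iteratedFDeriv_le_of_typeI_of_bounds 2`),
`R = max(R₀, 4JK²/θ²)` (the choice `R_{**} = max{R_*, 8πC²_{U,1}θ_*⁻²}`), `δ₀` from `hB`;
then for `C_p`: the bounds `B_u(C_u)`, `B_p(C_u, C_p)` (`PineauVicolOneSlicePressure`), the
scale `c₁`, `T₀`, `s₁`, and `s₀ = max(s₁, 1 − log T₀)`; for a solution and `t̄`: `hB` then
`hA` give the small core, (9.15)–(9.16) (`exists_cknE_le_of_core_small`) give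
`E(r; u) ≤ 10θ² < ε` for `r ≤ r₀ = min(√(−t̄), c₁/2, 1/32)`, hence for the zoom
`u_{r₀}` on all of `(0,1)` (`cknE_nsZoom`), and Prop. 9.5 concludes. [cite: PineauVicol2026, §9.2–§9.3, proof of Theorem 1.9, arXiv:2607.09619 p. 31–35] -/
theorem pineauVicol2026_oneSlice_regularity_of_core'
    (hA : ∃ ϑ : ℝ, 0 < ϑ ∧ ∀ θ : ℝ, 0 < θ → θ ≤ ϑ → ∀ Cu K K₂ : ℝ, ∃ R₀ : ℝ, 2 ≤ R₀ ∧
      ∀ R : ℝ, R₀ ≤ R → ∀ c₁ : ℝ, 0 < c₁ → ∃ T₀ : ℝ, 0 < T₀ ∧ T₀ ≤ 1 ∧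
      ∀ (u : ℝ → EuclideanSpace ℝ (Fin 3) → EuclideanSpace ℝ (Fin 3))
        (p : ℝ → EuclideanSpace ℝ (Fin 3) → ℝ),
        IsClassicalNSSolutionOnRegion
          (Ico (-1 : ℝ) 0 ×ˢ ball (0 : EuclideanSpace ℝ (Fin 3)) 1) 1 0 u p →
        (∀ t ∈ Ico (-1 : ℝ) 0, ∀ x ∈ ball (0 : EuclideanSpace ℝ (Fin 3)) 1,
          ‖u t x‖ ≤ Cu / (Real.sqrt (-t) + ‖x‖)) →
        (∀ t ∈ Ioo (-1 : ℝ) 0, ∀ x : EuclideanSpace ℝ (Fin 3), ‖x‖ + Real.sqrt (-t) ≤ c₁ →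
          ‖fderiv ℝ (u t) x‖ ≤ K / (‖x‖ + Real.sqrt (-t)) ^ 2) →
        (∀ t ∈ Ioo (-1 : ℝ) 0, ∀ x : EuclideanSpace ℝ (Fin 3), ‖x‖ + Real.sqrt (-t) ≤ c₁ →
          ‖iteratedFDeriv ℝ 2 (u t) x‖ ≤ K₂ / (‖x‖ + Real.sqrt (-t)) ^ 3) →
        ∀ tb ∈ Ioo (-T₀) 0,
          (∫⁻ x in ball (0 : EuclideanSpace ℝ (Fin 3)) (2 * R * Real.sqrt (-tb)),
              ENNReal.ofReal (‖curl (u tb) x‖ ^ 2) ≤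
            ENNReal.ofReal (θ ^ 2 / (4 * Real.sqrt (-tb)))) →
          ∀ t ∈ Ico tb 0,
            ∫⁻ x in ball (0 : EuclideanSpace ℝ (Fin 3)) (R / 2 * Real.sqrt (-t)),
                ENNReal.ofReal (frobeniusNormSq (fderiv ℝ (u t) x)) ≤
              ENNReal.ofReal (4 * θ ^ 2 / Real.sqrt (-t)))
    (hB : ∀ Cu : ℝ, 0 < Cu → ∀ θ : ℝ, 0 < θ → ∀ R : ℝ, 2 ≤ R → ∃ δ₀ : ℝ, 0 < δ₀ ∧ δ₀ ≤ 1 ∧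
      ∀ Cp : ℝ, 0 < Cp → ∃ s₁ : ℝ, 1 ≤ s₁ ∧
      ∀ (u : ℝ → EuclideanSpace ℝ (Fin 3) → EuclideanSpace ℝ (Fin 3))
        (p : ℝ → EuclideanSpace ℝ (Fin 3) → ℝ),
        IsClassicalNSSolutionOnRegion
          (Ico (-1 : ℝ) 0 ×ˢ ball (0 : EuclideanSpace ℝ (Fin 3)) 1) 1 0 u p →
        (∀ t ∈ Ico (-1 : ℝ) 0, ∀ x ∈ ball (0 : EuclideanSpace ℝ (Fin 3)) 1,
          ‖u t x‖ ≤ Cu / (Real.sqrt (-t) + ‖x‖)) →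
        (∀ t ∈ Ico (-1 : ℝ) 0, ∀ x : EuclideanSpace ℝ (Fin 3),
          1 / 2 < ‖x‖ → ‖x‖ < 3 / 4 → |p t x| ≤ Cp) →
        ∀ tb : ℝ, -Real.exp (-s₁) < tb → tb < 0 →
          (∀ x ∈ ball (0 : EuclideanSpace ℝ (Fin 3)) 1,
            ‖Real.sqrt (-tb) •
                ((-tb) • timeDerivOn (Ico (-1 : ℝ) 0 ×ˢ ball (0 : EuclideanSpace ℝ (Fin 3)) 1) u tb x
                  - (1 / 2 : ℝ) • u tb x - (1 / 2 : ℝ) • fderiv ℝ (u tb) x x)‖ ≤ δ₀) →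
          ∫⁻ x in ball (0 : EuclideanSpace ℝ (Fin 3)) (2 * R * Real.sqrt (-tb)),
              ENNReal.ofReal (‖curl (u tb) x‖ ^ 2) ≤
            ENNReal.ofReal (θ ^ 2 / (4 * Real.sqrt (-tb)))) :
    pineauVicol2026_oneSlice_regularity := by
  intro Cu hCu
  -- universal constants
  obtain ⟨ε, hε, Hzoom⟩ := pineauVicol_regular_of_zoom_small
  obtain ⟨J, hJ, Hglue⟩ := exists_cknE_le_of_core_small
  obtain ⟨K, hK0, HK⟩ := exists_forall_fderiv_le_of_typeI_of_bounds Cu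
  obtain ⟨K₂, -, HK₂⟩ := exists_forall_iteratedFDeriv_le_of_typeI_of_bounds 2 Cu
  obtain ⟨ϑ, hϑ, HA⟩ := hA
  -- `θ` with `10 θ² < ε`, `θ ≤ ϑ`
  set θ : ℝ := min ϑ (Real.sqrt (ε / 20)) with hθ_def
  have hθ0 : 0 < θ := lt_min hϑ (Real.sqrt_pos.2 (by positivity))
  have hθϑ : θ ≤ ϑ := min_le_left _ _
  have hθε : 10 * θ ^ 2 < ε := by
    have h1 : θ ≤ Real.sqrt (ε / 20) := min_le_right _ _
    have h2 : θ ^ 2 ≤ ε / 20 := by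
      calc θ ^ 2 ≤ (Real.sqrt (ε / 20)) ^ 2 := pow_le_pow_left₀ hθ0.le h1 2
        _ = ε / 20 := Real.sq_sqrt (by positivity)
    linarith
  obtain ⟨R₀, hR₀2, HA'⟩ := HA θ hθ0 hθϑ Cu K K₂
  -- `R` with `J K² / (R/2) ≤ θ²`
  set R : ℝ := max R₀ (4 * J * K ^ 2 / θ ^ 2) with hR_def
  have hRR₀ : R₀ ≤ R := le_max_left _ _
  have hR2 : 2 ≤ R := hR₀2.trans hRR₀
  have hR0 : 0 < R := by linarith
  have hJR : J * K ^ 2 / (R / 2) ≤ θ ^ 2 := by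
    have h1 : 4 * J * K ^ 2 / θ ^ 2 ≤ R := le_max_right _ _
    rw [div_le_iff₀ (by positivity)]
    rw [div_le_iff₀ (by positivity)] at h1
    nlinarith
  obtain ⟨δ₀, hδ₀, hδ₀1, HB⟩ := hB Cu hCu θ hθ0 R hR2
  refine ⟨δ₀, hδ₀, hδ₀1, fun Cp hCp => ?_⟩
  -- the global bounds `Bu(Cu)`, `Bp(Cu, Cp)` and the scale `c₁`
  obtain ⟨Bp, HBp⟩ := exists_lintegral_pressure_rpow_threeHalves_le Cu Cp
  set Tq : ℝ≥0∞ := ∫⁻ t in Ioo (-1 : ℝ) 0, ENNReal.ofReal ((-t) ^ (-(1 / 4 : ℝ))) with hTq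
  set Xq : ℝ≥0∞ := ∫⁻ x in ball (0 : EuclideanSpace ℝ (Fin 3)) 1,
    ENNReal.ofReal (‖x‖ ^ (-(5 / 2 : ℝ))) with hXq
  set Bu : ℝ≥0∞ := ENNReal.ofReal (Cu ^ 3) * (Tq * Xq) with hBu
  have hBut : Bu < ⊤ := ENNReal.mul_lt_top ENNReal.ofReal_lt_top
    (ENNReal.mul_lt_top lintegral_Ioo_neg_rpow_quarter_lt_top lintegral_ball_norm_rpow_lt_top)
  obtain ⟨c₁', hc₁', Hgrad'⟩ := HK Bu Bp hBut ENNReal.coe_lt_top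
  obtain ⟨c₂, hc₂, Hgrad2⟩ := HK₂ Bu Bp hBut ENNReal.coe_lt_top
  set c₁ : ℝ := min c₁' c₂ with hc₁_def
  have hc₁ : 0 < c₁ := lt_min hc₁' hc₂
  obtain ⟨T₀, hT₀, hT₀1, HA''⟩ := HA' R hRR₀ c₁ hc₁
  obtain ⟨s₁, hs₁, HB'⟩ := HB Cp hCp
  -- `s₀`
  set s₀ : ℝ := max s₁ (1 - Real.log T₀) with hs₀_def
  have hs₀1 : 1 ≤ s₀ := hs₁.trans (le_max_left _ _)
  have hexp : Real.exp (-s₀) ≤ T₀ := by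
    have h1 : -s₀ ≤ Real.log T₀ - 1 := by
      have := le_max_right s₁ (1 - Real.log T₀)
      linarith
    calc Real.exp (-s₀) ≤ Real.exp (Real.log T₀ - 1) := Real.exp_le_exp.2 h1
      _ ≤ Real.exp (Real.log T₀) := Real.exp_le_exp.2 (by linarith)
      _ = T₀ := Real.exp_log hT₀
  have hexp1 : Real.exp (-s₀) ≤ Real.exp (-s₁) :=
    Real.exp_le_exp.2 (neg_le_neg (le_max_left _ _))
  refine ⟨s₀, hs₀1, fun u p hreg hI hP tb htb1 htb0 hsl => ?_⟩
  have htbT : -T₀ < tb := by linarith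
  have htb1' : -Real.exp (-s₁) < tb := by linarith
  have htbm1 : -1 < tb := by
    have : Real.exp (-s₀) ≤ 1 := by
      rw [Real.exp_le_one_iff]; linarith
    linarith
  have hsq : 0 < Real.sqrt (-tb) := Real.sqrt_pos.2 (by linarith)
  -- the bounds of this solution
  have hBu_u : ∫⁻ w in Ioo (-1 : ℝ) 0 ×ˢ ball (0 : EuclideanSpace ℝ (Fin 3)) 1,
      ‖u w.1 w.2‖ₑ ^ (3 : ℕ) ≤ Bu := by
    refine le_trans (le_of_eq (lintegral_congr fun w => ?_)) (lintegral_typeI_cube_le hI)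
    rw [← ofReal_norm, ENNReal.ofReal_pow (norm_nonneg _)]
  have hgradu : ∀ t ∈ Ioo (-1 : ℝ) 0, ∀ x : EuclideanSpace ℝ (Fin 3), ‖x‖ + Real.sqrt (-t) ≤ c₁ →
      ‖fderiv ℝ (u t) x‖ ≤ K / (‖x‖ + Real.sqrt (-t)) ^ 2 := fun t ht x hx =>
    Hgrad' u p hreg hI hBu_u (HBp u p hreg hI hP) t ht x (hx.trans (min_le_left _ _))
  have hgrad2u : ∀ t ∈ Ioo (-1 : ℝ) 0, ∀ x : EuclideanSpace ℝ (Fin 3), ‖x‖ + Real.sqrt (-t) ≤ c₁ →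
      ‖iteratedFDeriv ℝ 2 (u t) x‖ ≤ K₂ / (‖x‖ + Real.sqrt (-t)) ^ 3 := fun t ht x hx =>
    Hgrad2 u p hreg hI hBu_u (HBp u p hreg hI hP) t ht x (hx.trans (min_le_right _ _))
  -- §9.3 then Lemma 9.4: the small core
  have hcurl := HB' u p hreg hI hP tb htb1' htb0 hsl
  have hcore := HA'' u p hreg hI hgradu hgrad2u tb ⟨htbT, htb0⟩ hcurl
  -- (9.15)–(9.16): `E(r; u) ≤ 10 θ²` for `r ≤ r₀`
  have hO : IsOpen (Ioo (-1 : ℝ) 0 ×ˢ ball (0 : EuclideanSpace ℝ (Fin 3)) 1) :=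
    isOpen_Ioo.prod isOpen_ball
  have hreg' := hreg.mono_of_isOpen (prod_mono Ioo_subset_Ico_self Subset.rfl) hO
  have hcont : ContinuousOn (fun w : ℝ × EuclideanSpace ℝ (Fin 3) => fderiv ℝ (u w.1) w.2)
      (Ioo (-1 : ℝ) 0 ×ˢ ball (0 : EuclideanSpace ℝ (Fin 3)) 1) :=
    continuousOn_fderiv_slice_of_isOpen hO hreg'.smooth_velocity (by exact_mod_cast le_top)
  have hcore' : ∀ t ∈ Ioo (-(-tb)) 0,
      ∫⁻ x in ball (0 : EuclideanSpace ℝ (Fin 3)) (R / 2 * Real.sqrt (-t)),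
          ENNReal.ofReal (frobeniusNormSq (fderiv ℝ (u t) x)) ≤
        ENNReal.ofReal (4 * θ ^ 2 / Real.sqrt (-t)) := by
    intro t ht
    exact hcore t ⟨by linarith [ht.1], ht.2⟩
  have hE : ∀ r : ℝ, 0 < r → r ≤ Real.sqrt (-tb) → r ≤ c₁ / 2 → r ≤ 1 →
      cknE r (0 : ℝ × EuclideanSpace ℝ (Fin 3)) (fun t x => fderiv ℝ (u t) x) ≤
        ENNReal.ofReal (10 * θ ^ 2) :=
    Hglue u θ K c₁ (R / 2) (-tb) hθ0 hK0 hc₁ (by positivity) (by linarith) hcont hcore' hgradu hJR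
  -- the zoom factor
  set c : ℝ := min (min (Real.sqrt (-tb)) (c₁ / 2)) (1 / 32) with hc_def
  have hc0 : 0 < c := lt_min (lt_min hsq (by positivity)) (by norm_num)
  have hc32 : c ≤ 1 / 32 := min_le_right _ _
  have hcsq : c ≤ Real.sqrt (-tb) := (min_le_left _ _).trans (min_le_left _ _)
  have hcc₁ : c ≤ c₁ / 2 := (min_le_left _ _).trans (min_le_right _ _)
  have hsup : (⨆ r ∈ Ioo (0 : ℝ) 1,
      cknE r (0 : ℝ × EuclideanSpace ℝ (Fin 3)) (fun t x => fderiv ℝ (nsRescale c u t) x)) <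
        ENNReal.ofReal ε := by
    refine lt_of_le_of_lt (iSup₂_le fun r hr => ?_) ((ENNReal.ofReal_lt_ofReal_iff hε).2 hθε)
    have h3 : stAffine (c ^ 2) c 0 (0 : EuclideanSpace ℝ (Fin 3)) (0 : ℝ × EuclideanSpace ℝ (Fin 3)) = 0 := by
      simp [stAffine]
    rw [fderiv_nsRescale_eq_smul_stPull, cknE_nsZoom hc0 hr.1 0 0 0, h3]
    refine hE (c * r) (mul_pos hc0 hr.1) ?_ ?_ ?_
    · calc c * r ≤ c * 1 := by gcongr; exact hr.2.le
        _ ≤ Real.sqrt (-tb) := by rw [mul_one]; exact hcsq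
    · calc c * r ≤ c * 1 := by gcongr; exact hr.2.le
        _ ≤ c₁ / 2 := by rw [mul_one]; exact hcc₁
    · calc c * r ≤ c * 1 := by gcongr; exact hr.2.le
        _ ≤ 1 := by rw [mul_one]; linarith
  exact Hzoom u p Cu Cp c hreg hI hP hc0 hc32 hsup

end Reduction

end Literature.Analysis.FluidPDE

end
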